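import Summits.QuantumFields.YangMills.Theorems.ColdStartUniversalityLatticeLangevinWilsonDirichletScaleSeminorm
import HarnessLib

/-!
# Route `ColdStartUniversality` (fixed-cut-off `L²(μ_{β'})` package): the energy `𝓔_h(G − κ_s G)` of a continuous observable
# minus its semigroup image is SMALL AT SMALL SCALES — right-continuity of the right derivative of the convex autocorrelation
# function, with no generator and no spectral theorem

Helper file (seat `ym-line-csu-p1`, g18; `--supports stmt-QuantumFields-27363`), sequel of `…WilsonDirichletScaleSeminorm`.  For
the SU(2) lattice Langevin dynamics of Shen–Zhu–Zhu at any `L, β'` (reversible w.r.t. `μ = μ_{β'}`), a continuous `G`, `G₀ = G − μG`,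
`Φ(u) = ∫ G₀ κ_u G₀ dμ` and `Q_h(w) = ∫ w² dμ − ∫ w κ_h w dμ = h 𝓔_h(w)`:

* `secant_shift_mono_of_convexOn` — secants of a convex function over `[a, a+h]` increase with `a`.
* `dirichletScale_sub_transition_eq` — `Q_h(G − κ_sG) = [Φ(0)−Φ(h)] − 2[Φ(s)−Φ(s+h)] + [Φ(2s)−Φ(2s+h)]` (Chapman–Kolmogorov +
  reversibility).
* ★ `dirichletScale_sub_transition_le` — if `𝓔_h(G) ≤ E` for all `h > 0` and `E − ε < 𝓔_{h₁}(G)`, then `𝓔_h(G − κ_sG) ≤ 2ε` for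
  all `0 < s ≤ s₀`, `0 < h ≤ h₀`: the three forward slopes `D_h(0) ≤ E`, `D_h(s) ≥ E − 2ε` (`exists_forward_slope_ge_of_convexOn`),
  `D_h(2s) ≤ D_h(s)`.

THEOREMS ONLY, no definition, no sorry.  HONEST FRAMING: RECORD-rung R3 plumbing at FIXED cut-off (input of the unconditional
«generator-form Poincaré ⇒ `L²` decay» of the sequel); nothing K-uniform is proved; no crux, rung or summit statement is proved;
the Yang–Mills mass gap is NOT proved.
-/

set_option autoImplicit false

noncomputable section

namespace Summit.QuantumFields.YangMills.Theorems.ColdStartUniversality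

open MeasureTheory ProbabilityTheory Filter Set Topology
open scoped BigOperators NNReal ENNReal
open Literature.Probability.Process Literature.MathematicalPhysics.QuantumFieldTheory
open Literature.MathematicalPhysics.QuantumLattice (fundamentalRep fundamentalLatticeRep continuous_fundamentalRep)

variable {L : ℕ} [NeZero L]

/-! ## The energy of `G − κ_s G` at small scales -/

/-- **Secants of a convex function over shifted intervals**: for `φ` convex on `[0,∞)`, `0 ≤ a ≤ c`, `h > 0`:
`(φ(a+h) − φ(a))/h ≤ (φ(c+h) − φ(c))/h` (two applications of three-point secant monotonicity). [cite: HardyLittlewoodPolya1952, §3.18 (111)] -/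
theorem secant_shift_mono_of_convexOn {φ : ℝ → ℝ} (hφ : ConvexOn ℝ (Ici 0) φ) {a c h : ℝ} (ha : 0 ≤ a) (hac : a ≤ c)
    (hh : 0 < h) : (φ (a + h) - φ a) / h ≤ (φ (c + h) - φ c) / h := by
  rcases eq_or_lt_of_le hac with heq | hlt
  · rw [heq]
  -- `slope(a, a+h) ≤ slope(a, c+h)`
  have h1 := hφ.secant_mono (a := a) (x := a + h) (y := c + h)
    (by simp only [mem_Ici]; exact ha) (by simp only [mem_Ici]; linarith) (by simp only [mem_Ici]; linarith)
    (by linarith) (by linarith) (by linarith)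
  rw [show a + h - a = h by ring] at h1
  -- `slope(a, c+h) ≤ slope(c, c+h)` (secants from the base point `c + h`)
  have h2 := hφ.secant_mono (a := c + h) (x := a) (y := c)
    (by simp only [mem_Ici]; linarith) (by simp only [mem_Ici]; exact ha) (by simp only [mem_Ici]; linarith)
    (by linarith) (by linarith) hlt.le
  have e2 : (φ a - φ (c + h)) / (a - (c + h)) = (φ (c + h) - φ a) / (c + h - a) := by
    rw [← neg_sub, ← neg_sub (c + h) a, neg_div_neg_eq]
  have e3 : (φ c - φ (c + h)) / (c - (c + h)) = (φ (c + h) - φ c) / h := by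
    rw [← neg_sub, show c - (c + h) = -h by ring, neg_div_neg_eq]
  rw [e2, e3] at h2
  exact h1.trans h2

/-- **Expansion of `Q_h(G − κ_sG)` along the autocorrelation function**: with `G₀ = G − μG` and `Φ(u) = ∫ G₀ κ_u G₀ dμ_{β'}`,
`∫ u² dμ − ∫ u κ_h u dμ = [Φ(0) − Φ(h)] − 2[Φ(s) − Φ(s+h)] + [Φ(2s) − Φ(2s+h)]` for `u = G − κ_sG` (Chapman–Kolmogorov and
reversibility: `∫ κ_sG₀ · κ_tG₀ dμ = Φ(s+t)`). [folklore] -/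
theorem dirichletScale_sub_transition_eq (L : ℕ) [NeZero L] (β' : ℝ)
    (κ : ℝ≥0 → Kernel (GaugeConfig 3 L (Matrix.specialUnitaryGroup (Fin 2) ℂ))
      (GaugeConfig 3 L (Matrix.specialUnitaryGroup (Fin 2) ℂ))) [∀ t, IsMarkovKernel (κ t)]
    (hreal : ∀ (t : ℝ≥0) (x : GaugeConfig 3 L (Matrix.specialUnitaryGroup (Fin 2) ℂ))
        (Ω : Type) [MeasurableSpace Ω] (P : Measure Ω) [IsProbabilityMeasure P]
        (W : ℝ≥0 → Ω → (Edge 3 L × NoiseIdx 2 → ℝ)) (hW : IsFlatBrownian W P)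
        (U : ℝ≥0 → Ω → GaugeConfig 3 L (Matrix.specialUnitaryGroup (Fin 2) ℂ)),
        (∀ ω, U 0 ω = x) →
        (latticeLangevinDynamics (fundamentalLatticeRep 2) β').IsSolution (fundamentalRep (Fin 2))
          hW.natFiltration P W U →
        κ t x = P.map (U t))
    (s h : ℝ≥0) {G : GaugeConfig 3 L (Matrix.specialUnitaryGroup (Fin 2) ℂ) → ℝ} (hG : Continuous G) :
    let μ : Measure (GaugeConfig 3 L (Matrix.specialUnitaryGroup (Fin 2) ℂ)) :=
      wilsonMeasure (d := 3) (L := L) (fundamentalRep (Fin 2)) β'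
    let G₀ : GaugeConfig 3 L (Matrix.specialUnitaryGroup (Fin 2) ℂ) → ℝ := fun x => G x - ∫ z, G z ∂μ
    (∫ x, (G x - ∫ y, G y ∂(κ s x)) * (G x - ∫ y, G y ∂(κ s x)) ∂μ) -
        ∫ x, (G x - ∫ y, G y ∂(κ s x)) * (∫ y, (G y - ∫ z, G z ∂(κ s y)) ∂(κ h x)) ∂μ =
      ((∫ x, G₀ x * G₀ x ∂μ) - ∫ x, G₀ x * (∫ y, G₀ y ∂(κ h x)) ∂μ) -
        2 * ((∫ x, G₀ x * (∫ y, G₀ y ∂(κ s x)) ∂μ) - ∫ x, G₀ x * (∫ y, G₀ y ∂(κ (s + h) x)) ∂μ) +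
        ((∫ x, G₀ x * (∫ y, G₀ y ∂(κ (s + s) x)) ∂μ) - ∫ x, G₀ x * (∫ y, G₀ y ∂(κ (s + s + h) x)) ∂μ) := by
  intro μ G₀
  classical
  haveI := secondCountableTopology_su2
  haveI := borelSpace_config L
  haveI : IsProbabilityMeasure μ :=
    isProbabilityMeasure_wilsonMeasure (d := 3) (L := L) (fundamentalRep (Fin 2)) (continuous_fundamentalRep (Fin 2)) β'
  set m : ℝ := ∫ z, G z ∂μ with hm
  have hG₀def : ∀ x, G₀ x = G x - m := fun x => rfl
  have hG₀c : Continuous G₀ := hG.sub continuous_const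
  obtain ⟨M, -, hM⟩ := exists_abs_le_of_continuous hG
  obtain ⟨M₀, -, hM₀⟩ := exists_abs_le_of_continuous hG₀c
  have hGi : ∀ (ν : Measure (GaugeConfig 3 L (Matrix.specialUnitaryGroup (Fin 2) ℂ))) [IsProbabilityMeasure ν],
      Integrable G ν := fun ν _ =>
    Integrable.of_bound hG.aestronglyMeasurable M (Eventually.of_forall fun z => by rw [Real.norm_eq_abs]; exact hM z)
  have hG₀i : ∀ (ν : Measure (GaugeConfig 3 L (Matrix.specialUnitaryGroup (Fin 2) ℂ))) [IsProbabilityMeasure ν],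
      Integrable G₀ ν := fun ν _ =>
    Integrable.of_bound hG₀c.aestronglyMeasurable M₀ (Eventually.of_forall fun z => by rw [Real.norm_eq_abs]; exact hM₀ z)
  have hκG₀ : ∀ (u : ℝ≥0) x, ∫ y, G₀ y ∂(κ u x) = (∫ y, G y ∂(κ u x)) - m := by
    intro u x
    simp only [hG₀def]
    rw [integral_sub (hGi _) (integrable_const m), integral_const, probReal_univ, one_smul]
  -- the kernel images of `G₀`
  set Ks : GaugeConfig 3 L (Matrix.specialUnitaryGroup (Fin 2) ℂ) → ℝ := fun x => ∫ y, G₀ y ∂(κ s x) with hKs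
  set Kh : GaugeConfig 3 L (Matrix.specialUnitaryGroup (Fin 2) ℂ) → ℝ := fun x => ∫ y, G₀ y ∂(κ h x) with hKh
  set Khs : GaugeConfig 3 L (Matrix.specialUnitaryGroup (Fin 2) ℂ) → ℝ := fun x => ∫ y, G₀ y ∂(κ (h + s) x) with hKhs
  have hKsc : Continuous Ks := continuous_integral_transitionKernel L β' κ hreal s hG₀c
  have hKhc : Continuous Kh := continuous_integral_transitionKernel L β' κ hreal h hG₀c
  have hKhsc : Continuous Khs := continuous_integral_transitionKernel L β' κ hreal (h + s) hG₀c
  -- `u = G₀ − κ_sG₀` and `κ_h u = κ_hG₀ − κ_{h+s}G₀`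
  have hu : ∀ x, G x - ∫ y, G y ∂(κ s x) = G₀ x - Ks x := by
    intro x; simp only [hKs]; rw [hκG₀ s x, hG₀def]; ring
  have hCK : κ (h + s) = κ s ∘ₖ κ h := chapmanKolmogorov_szz β' κ hreal h s
  have eCK : ∀ x, ∫ y, Ks y ∂(κ h x) = Khs x := by
    intro x
    simp only [hKs, hKhs]
    haveI : IsProbabilityMeasure ((κ s ∘ₖ κ h) x) := by rw [← hCK]; infer_instance
    rw [hCK]
    exact (Kernel.integral_comp (hG₀i _)).symm
  have hKsi : ∀ x, Integrable Ks (κ h x) := fun x => by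
    obtain ⟨M', -, hM'⟩ := exists_abs_le_of_continuous hKsc
    exact Integrable.of_bound hKsc.aestronglyMeasurable M' (Eventually.of_forall fun z => by rw [Real.norm_eq_abs]; exact hM' z)
  have hκu : ∀ x, ∫ y, (G y - ∫ z, G z ∂(κ s y)) ∂(κ h x) = Kh x - Khs x := by
    intro x
    simp_rw [hu]
    rw [integral_sub (hG₀i _) (hKsi x), eCK x]
  simp_rw [hκu, hu]
  -- the autocorrelation identities
  have e2s : ∫ x, Ks x * Ks x ∂μ = ∫ x, G₀ x * (∫ y, G₀ y ∂(κ (s + s) x)) ∂μ := by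
    rw [integral_mul_transition_self_eq_sq L β' κ hreal s hG₀c]
    exact integral_congr_ae (Eventually.of_forall fun x => by simp only [hKs]; ring)
  have esh : ∫ x, Ks x * Kh x ∂μ = ∫ x, G₀ x * (∫ y, G₀ y ∂(κ (s + h) x)) ∂μ :=
    integral_transition_mul_transition_eq L β' κ hreal s h hG₀c
  have eshs : ∫ x, Ks x * Khs x ∂μ = ∫ x, G₀ x * (∫ y, G₀ y ∂(κ (s + s + h) x)) ∂μ := by
    have e := integral_transition_mul_transition_eq L β' κ hreal s (h + s) hG₀c
    rw [show s + (h + s) = s + s + h by ring] at e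
    exact e
  have eGhs : ∫ x, G₀ x * Khs x ∂μ = ∫ x, G₀ x * (∫ y, G₀ y ∂(κ (s + h) x)) ∂μ := by
    simp only [hKhs, add_comm h s]
  -- integrability of the products
  have i00 : Integrable (fun x => G₀ x * G₀ x) μ := integrable_of_continuous_of_compactSpace (hG₀c.mul hG₀c) μ
  have i0s : Integrable (fun x => G₀ x * Ks x) μ := integrable_of_continuous_of_compactSpace (hG₀c.mul hKsc) μ
  have iss : Integrable (fun x => Ks x * Ks x) μ := integrable_of_continuous_of_compactSpace (hKsc.mul hKsc) μ
  have i0h : Integrable (fun x => G₀ x * Kh x) μ := integrable_of_continuous_of_compactSpace (hG₀c.mul hKhc) μ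
  have i0hs : Integrable (fun x => G₀ x * Khs x) μ := integrable_of_continuous_of_compactSpace (hG₀c.mul hKhsc) μ
  have ish : Integrable (fun x => Ks x * Kh x) μ := integrable_of_continuous_of_compactSpace (hKsc.mul hKhc) μ
  have ishs : Integrable (fun x => Ks x * Khs x) μ := integrable_of_continuous_of_compactSpace (hKsc.mul hKhsc) μ
  have ea : ∫ x, (G₀ x - Ks x) * (G₀ x - Ks x) ∂μ =
      (∫ x, G₀ x * G₀ x ∂μ) - 2 * (∫ x, G₀ x * Ks x ∂μ) + ∫ x, Ks x * Ks x ∂μ := by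
    have e : ∀ x, (G₀ x - Ks x) * (G₀ x - Ks x) = (G₀ x * G₀ x - 2 * (G₀ x * Ks x)) + Ks x * Ks x := by intro x; ring
    simp_rw [e]
    have i2 : Integrable (fun x => 2 * (G₀ x * Ks x)) μ := i0s.const_mul _
    have i12 : Integrable (fun x => G₀ x * G₀ x - 2 * (G₀ x * Ks x)) μ := i00.sub i2
    rw [integral_add i12 iss, integral_sub i00 i2, integral_const_mul]
  have eb : ∫ x, (G₀ x - Ks x) * (Kh x - Khs x) ∂μ =
      (∫ x, G₀ x * Kh x ∂μ) - (∫ x, G₀ x * Khs x ∂μ) - (∫ x, Ks x * Kh x ∂μ) + ∫ x, Ks x * Khs x ∂μ := by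
    have e : ∀ x, (G₀ x - Ks x) * (Kh x - Khs x) = ((G₀ x * Kh x - G₀ x * Khs x) - Ks x * Kh x) + Ks x * Khs x := by
      intro x; ring
    simp_rw [e]
    have i12 : Integrable (fun x => G₀ x * Kh x - G₀ x * Khs x) μ := i0h.sub i0hs
    have i123 : Integrable (fun x => (G₀ x * Kh x - G₀ x * Khs x) - Ks x * Kh x) μ := i12.sub ish
    rw [integral_add i123 ishs, integral_sub i12 ish, integral_sub i0h i0hs]
  rw [ea, eb, e2s, esh, eshs, eGhs]
  ring

/-- ★ **The energy of `G − κ_s G` is small at small scales.**  If `𝓔_h(G) ≤ E` for all `h > 0` and `E − ε < 𝓔_{h₁}(G)` for some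
`h₁ > 0` (so `E` is the supremum up to `ε`), then there are `s₀, h₀ > 0` with `𝓔_h(G − κ_sG) ≤ 2ε` for all `0 < s ≤ s₀`, `0 < h ≤ h₀`.
Proof: `𝓔_h(G − κ_sG) = D_h(0) − 2D_h(s) + D_h(2s)` with `D_h(v) = (Φ(v) − Φ(v+h))/h` (`dirichletScale_sub_transition_eq`);
`D_h(2s) ≤ D_h(s)` (convexity), `D_h(0) ≤ E`, and `D_h(s) ≥ (Φ(0) − Φ(h₁))/h₁ − ε > E − 2ε` for small `s` and `s + h ≤ h₁`
(`exists_forward_slope_ge_of_convexOn`).  No spectral theorem, no generator. [cite: BakryGentilLedoux2014, §3.1.8 and Remark 4.3.3] -/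
theorem dirichletScale_sub_transition_le (L : ℕ) [NeZero L] (β' : ℝ)
    (κ : ℝ≥0 → Kernel (GaugeConfig 3 L (Matrix.specialUnitaryGroup (Fin 2) ℂ))
      (GaugeConfig 3 L (Matrix.specialUnitaryGroup (Fin 2) ℂ))) [∀ t, IsMarkovKernel (κ t)]
    (hreal : ∀ (t : ℝ≥0) (x : GaugeConfig 3 L (Matrix.specialUnitaryGroup (Fin 2) ℂ))
        (Ω : Type) [MeasurableSpace Ω] (P : Measure Ω) [IsProbabilityMeasure P]
        (W : ℝ≥0 → Ω → (Edge 3 L × NoiseIdx 2 → ℝ)) (hW : IsFlatBrownian W P)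
        (U : ℝ≥0 → Ω → GaugeConfig 3 L (Matrix.specialUnitaryGroup (Fin 2) ℂ)),
        (∀ ω, U 0 ω = x) →
        (latticeLangevinDynamics (fundamentalLatticeRep 2) β').IsSolution (fundamentalRep (Fin 2))
          hW.natFiltration P W U →
        κ t x = P.map (U t))
    {G : GaugeConfig 3 L (Matrix.specialUnitaryGroup (Fin 2) ℂ) → ℝ} (hG : Continuous G) {E ε : ℝ}
    (hE : ∀ h : ℝ≥0, 0 < h →
      (h : ℝ)⁻¹ * ((∫ x, G x * G x ∂(wilsonMeasure (d := 3) (L := L) (fundamentalRep (Fin 2)) β')) -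
        ∫ x, G x * (∫ y, G y ∂(κ h x)) ∂(wilsonMeasure (d := 3) (L := L) (fundamentalRep (Fin 2)) β')) ≤ E)
    (hε : 0 < ε) {h₁ : ℝ≥0} (hh₁ : 0 < h₁)
    (hopt : E - ε < (h₁ : ℝ)⁻¹ * ((∫ x, G x * G x ∂(wilsonMeasure (d := 3) (L := L) (fundamentalRep (Fin 2)) β')) -
        ∫ x, G x * (∫ y, G y ∂(κ h₁ x)) ∂(wilsonMeasure (d := 3) (L := L) (fundamentalRep (Fin 2)) β'))) :
    ∃ s₀ : ℝ≥0, 0 < s₀ ∧ ∃ h₀ : ℝ≥0, 0 < h₀ ∧ ∀ s : ℝ≥0, 0 < s → s ≤ s₀ → ∀ h : ℝ≥0, 0 < h → h ≤ h₀ →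
      (h : ℝ)⁻¹ * ((∫ x, (G x - ∫ y, G y ∂(κ s x)) * (G x - ∫ y, G y ∂(κ s x))
          ∂(wilsonMeasure (d := 3) (L := L) (fundamentalRep (Fin 2)) β')) -
        ∫ x, (G x - ∫ y, G y ∂(κ s x)) * (∫ y, (G y - ∫ z, G z ∂(κ s y)) ∂(κ h x))
          ∂(wilsonMeasure (d := 3) (L := L) (fundamentalRep (Fin 2)) β')) ≤ 2 * ε := by
  classical
  haveI := secondCountableTopology_su2
  haveI := borelSpace_config L
  set μ : Measure (GaugeConfig 3 L (Matrix.specialUnitaryGroup (Fin 2) ℂ)) :=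
    wilsonMeasure (d := 3) (L := L) (fundamentalRep (Fin 2)) β' with hμ
  haveI : IsProbabilityMeasure μ :=
    isProbabilityMeasure_wilsonMeasure (d := 3) (L := L) (fundamentalRep (Fin 2)) (continuous_fundamentalRep (Fin 2)) β'
  set m : ℝ := ∫ z, G z ∂μ with hm
  set G₀ : GaugeConfig 3 L (Matrix.specialUnitaryGroup (Fin 2) ℂ) → ℝ := fun x => G x - m with hG₀
  have hG₀c : Continuous G₀ := hG.sub continuous_const
  -- the convex, continuous autocorrelation function
  set Φ : ℝ → ℝ := fun u => ∫ x, G₀ x * (∫ y, G₀ y ∂(κ u.toNNReal x)) ∂μ with hΦ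
  have hconv : ConvexOn ℝ (Ici (0 : ℝ)) Φ := convexOn_integral_mul_transition L β' κ hreal hG₀c
  have hΦc : Continuous Φ := (continuous_integral_mul_transition L β' κ hreal hG₀c hG₀c).comp continuous_real_toNNReal
  have hκ0 : κ 0 = Kernel.id := transitionKernel_zero_eq_id L β' κ hreal
  have eΦ0 : ∫ x, G₀ x * G₀ x ∂μ = Φ 0 := by
    simp only [hΦ, Real.toNNReal_zero, hκ0, Kernel.id_apply, integral_dirac]
  have eΦ : ∀ u : ℝ≥0, ∫ x, G₀ x * (∫ y, G₀ y ∂(κ u x)) ∂μ = Φ u := fun u => by simp only [hΦ, Real.toNNReal_coe]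
  -- `h⁻¹ Q_h(G) = (Φ 0 − Φ h)/h`
  have hDG : ∀ u : ℝ≥0, (u : ℝ)⁻¹ * ((∫ x, G x * G x ∂μ) - ∫ x, G x * (∫ y, G y ∂(κ u x)) ∂μ) = (Φ 0 - Φ u) / u := by
    intro u
    rw [dirichletScale_eq_centred L β' κ hreal u hG, eΦ0, eΦ u, inv_mul_eq_div]
  -- forward slopes at small `s` (right-continuity of the right derivative at `0`)
  have hh₁R : (0 : ℝ) < h₁ := by exact_mod_cast hh₁
  obtain ⟨δ, hδ, hδh₁, hslope⟩ := exists_forward_slope_ge_of_convexOn hconv hΦc.continuousWithinAt hh₁R hε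
  have hopt' : E - ε < (Φ 0 - Φ h₁) / h₁ := by rw [← hDG h₁]; exact hopt
  refine ⟨δ.toNNReal, Real.toNNReal_pos.2 hδ, ((h₁ : ℝ) - δ).toNNReal, Real.toNNReal_pos.2 (by linarith),
    fun s hs hsδ h hh hhδ => ?_⟩
  have hsR : (0 : ℝ) < s := by exact_mod_cast hs
  have hhR : (0 : ℝ) < h := by exact_mod_cast hh
  have hsδR : (s : ℝ) ≤ δ := by
    have := NNReal.coe_le_coe.2 hsδ; rwa [Real.coe_toNNReal _ hδ.le] at this
  have hhδR : (h : ℝ) ≤ h₁ - δ := by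
    have := NNReal.coe_le_coe.2 hhδ; rwa [Real.coe_toNNReal _ (by linarith)] at this
  -- the expansion
  have hexp := dirichletScale_sub_transition_eq L β' κ hreal s h hG
  dsimp only at hexp
  rw [hexp, eΦ0, eΦ h, eΦ s, eΦ (s + h), eΦ (s + s), eΦ (s + s + h)]
  push_cast
  -- the three slope bounds
  have hD0 : (Φ 0 - Φ h) / h ≤ E := by rw [← hDG h]; exact hE h hh
  have hDs : (Φ 0 - Φ h₁) / h₁ - ε ≤ (Φ s - Φ (s + h)) / h := hslope s hsR hsδR h hhR (by linarith)
  have hD2s : (Φ (s + s + h) - Φ (s + s)) / h ≥ (Φ (s + h) - Φ s) / h :=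
    secant_shift_mono_of_convexOn hconv hsR.le (by linarith) hhR
  rw [ge_iff_le, div_le_div_iff_of_pos_right hhR] at hD2s
  rw [div_le_iff₀ hhR] at hD0
  have hDs' : ((Φ 0 - Φ h₁) / h₁ - ε) * h ≤ Φ s - Φ (s + h) := (le_div_iff₀ hhR).1 hDs
  have hopt2 : (E - ε) * h < ((Φ 0 - Φ h₁) / h₁) * h := mul_lt_mul_of_pos_right hopt' hhR
  rw [inv_mul_le_iff₀ hhR]
  nlinarith [hD0, hDs', hD2s, hopt2]

end Summit.QuantumFields.YangMills.Theorems.ColdStartUniversality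

end
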